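import Mathlib
import HarnessLib
import Summits.Ventures.LatticeQCDFlow.Exactness.FlowedChargeLocality
import Summits.Ventures.LatticeQCDFlow.Scoring.WilsonFlowRK3TimeReflection

/-!
# The measured (RK3-flowed) slab charge across the LINK plane: supported in the positive-time half for slices deep enough, hence non-positively correlated with its mirror slice `1 − t` for every `β ≥ 0` (the odd separations)

HONEST FRAMING: exact (Metropolis-corrected) sampling algorithms for lattice gauge theory;
figures of merit are autocorrelation/cost numbers at stated couplings and volumes; no
continuum-physics claim.

Venture `LatticeQCDFlow` (cell pub-lqcd), topic `Exactness`, FANOUT row 21 (`su3-base`).  The link-plane companion of row 21's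
`Exactness/FlowedChargeLocality` (site plane, every `β`, even separations), using that file's time-locality of the RK3 scheme
(`iterate_wilsonFlowRK3_eq_of_agree`, radius `3m`) and row 21's `Scoring/WilsonFlowRK3TimeReflection`
(`iterate_wilsonFlowRK3_timeReflect`: the integrator commutes with the link reflection `Θ`, `t ↦ 1 − t`), with the Literature's
link-plane reflection positivity (`FariaDaVeigaOCarroll2022.integral_mul_timeReflect_nonneg`, `β ≥ 0`) and clover parity.
NEW WORK of the cell, def-free; nothing cited as a fact; no number.

* §1 **`dependsOn_rk3SlabCharge_posEdges`** — for `3m + 2 ≤ t.val`, `t.val + 3m + 2 ≤ L/2` the flowed slab charge of the slice `t`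
  depends only on the positive-time links `Λ₊ = {1 ≤ · ≤ L/2}` (a link based at a time value in `[1, L/2 − 1]` is positive).
* §2 **`integral_rk3SlabCharge_mul_linkMirror_nonpos`** — `SU(n)`, `L` even, `β ≥ 0`, every `ε'`, `m`, such `t`:
  `∫ (Σ_{x₀=t} P_x ∘ RK3^m)·(Σ_{x₀=t} P_{θx} ∘ RK3^m) dμ_β ≤ 0` (mirror slice `1 − t`, separation `2t.val − 1`).
NOT CLAIMED: as in the parent — the certified footprint `3m` is linear in `m`; `β < 0`; spatial windows; numbers.
-/

noncomputable section

namespace Summit.Ventures.LatticeQCDFlow.Exactness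

open MeasureTheory
open Literature.MathematicalPhysics.QuantumFieldTheory
open Literature.MathematicalPhysics.QuantumLattice (cloverPseudoscalar cloverPseudoscalar_reflect continuous_cloverPseudoscalar
  exists_abs_cloverPseudoscalar_le cloverEdges fundamentalRep continuous_fundamentalRep fundamentalRep_mem_unitaryGroup)
open Summit.Ventures.LatticeQCDFlow.Scoring (wilsonFlowRK3 iterate_wilsonFlowRK3_timeReflect continuous_iterate_wilsonFlowRK3)

/-! ## §1 The flowed slab charge of a slice deep in the half-space is an observable of the positive-time links -/

section Support

variable {L n : ℕ} [NeZero L]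

/-- **SUPPORT OF THE FLOWED SLAB CHARGE, LINK PLANE**: for a slice `t` with `3m + 2 ≤ t.val` and `t.val + 3m + 2 ≤ L/2`, the
flowed slab charge `Σ_{x : x₀ = t} P_x(RK3_{ε'}^m U)` depends only on the positive-time links `Λ₊ = {1 ≤ t ≤ L/2}` of the link
reflection. -/
theorem dependsOn_rk3SlabCharge_posEdges (ε' : ℝ) (m : ℕ) (t : ZMod L) (hlo : 3 * m + 2 ≤ t.val)
    (hhi : t.val + 3 * m + 2 ≤ L / 2) :
    DependsOn (fun U : GaugeConfig 4 L (Matrix.specialUnitaryGroup (Fin n) ℂ) =>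
        ∑ x ∈ Finset.univ.filter (fun x : Site 4 L => x 0 = t),
          cloverPseudoscalar (fundamentalRep (Fin n)) x ((wilsonFlowRK3 ε')^[m] U))
      {e : Edge 4 L | WilsonRP.IsPosEdge e} := by
  have hL2 : L / 2 < L := Nat.div_lt_self (Nat.pos_of_ne_zero (NeZero.ne L)) one_lt_two
  intro U V hUV
  refine Finset.sum_congr rfl fun x hx => ?_
  have hxt : x 0 = t := by simpa using hx
  -- the flowed fields agree on every link based at a time value in `[t − 1, t + 1]`
  have hagree : ∀ e : Edge 4 L, t.val - 1 ≤ (e.1 0).val → (e.1 0).val ≤ t.val + 1 →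
      (wilsonFlowRK3 ε')^[m] U e = (wilsonFlowRK3 ε')^[m] V e := by
    refine iterate_wilsonFlowRK3_eq_of_agree ε' m (lo := t.val - 1) (hi := t.val + 1) (by omega) (by omega) ?_
    intro e h1 h2
    apply hUV
    -- a link based at a time value in `[1, L/2 − 1]` is a positive-time link (its far end is at most one slice later)
    have hfar : ((e.1.shift e.2) 0).val = (e.1 0).val + (if e.2 = 0 then 1 else 0) := by
      by_cases he0 : e.2 = 0
      · rw [if_pos he0, Site.shift, he0]
        have := (zmod_val_pred_succ (t := e.1 0) (by omega) (by omega)).2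
        simpa using this
      · rw [if_neg he0, Site.shift]
        simp [Ne.symm he0]
    refine ⟨by omega, by omega, ?_, ?_⟩ <;> rw [hfar] <;> split_ifs <;> omega
  -- links based at a time in `{x₀, x₀ − 1, x₀ + 1}` are therefore read identically
  obtain ⟨hp, hs⟩ := zmod_val_pred_succ (t := x 0) (by rw [hxt]; omega) (by rw [hxt]; omega)
  have hb : ∀ e : Edge 4 L, (e.1 0 = x 0 ∨ e.1 0 = x 0 - 1 ∨ e.1 0 = x 0 + 1) →
      (wilsonFlowRK3 ε')^[m] U e = (wilsonFlowRK3 ε')^[m] V e := by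
    intro e he
    refine hagree e ?_ ?_ <;> rcases he with h | h | h <;> rw [h] <;> (try rw [hp]) <;> (try rw [hs]) <;> rw [hxt] <;> omega
  -- the clover at `x` reads only links of the six coordinate-plane clovers, all based at such times
  have h0 : ∀ i : Fin 4, i ≠ 0 → ∀ e ∈ cloverEdges x 0 i, (wilsonFlowRK3 ε')^[m] U e = (wilsonFlowRK3 ε')^[m] V e := by
    intro i hi e he
    apply hb
    simp only [cloverEdges, Finset.mem_insert, Finset.mem_singleton] at he
    rcases he with rfl | rfl | rfl | rfl | rfl | rfl | rfl | rfl | rfl | rfl | rfl | rfl <;>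
      simp [Ne.symm hi, sub_eq_add_neg, add_comm]
  have hsp : ∀ i j : Fin 4, i ≠ 0 → j ≠ 0 → ∀ e ∈ cloverEdges x i j,
      (wilsonFlowRK3 ε')^[m] U e = (wilsonFlowRK3 ε')^[m] V e := by
    intro i j hi hj e he
    apply hb
    simp only [cloverEdges, Finset.mem_insert, Finset.mem_singleton] at he
    rcases he with rfl | rfl | rfl | rfl | rfl | rfl | rfl | rfl | rfl | rfl | rfl | rfl <;>
      simp [Ne.symm hi, Ne.symm hj]
  have hC : ∀ μ ν : Fin 4, (μ = 0 ∧ ν ≠ 0) ∨ (μ ≠ 0 ∧ ν ≠ 0) →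
      Literature.MathematicalPhysics.QuantumLattice.flowedClover (fundamentalRep (Fin n)) 0 ((wilsonFlowRK3 ε')^[m] U) x μ ν =
        Literature.MathematicalPhysics.QuantumLattice.flowedClover (fundamentalRep (Fin n)) 0 ((wilsonFlowRK3 ε')^[m] V) x μ ν := by
    intro μ ν h
    rcases h with ⟨hμ, hν⟩ | ⟨hμ, hν⟩
    · subst hμ
      exact Literature.MathematicalPhysics.QuantumLattice.flowedClover_zero_congr _ (h0 ν hν)
    · exact Literature.MathematicalPhysics.QuantumLattice.flowedClover_zero_congr _ (hsp μ ν hμ hν)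
  rw [Literature.MathematicalPhysics.QuantumLattice.cloverPseudoscalar_def,
    Literature.MathematicalPhysics.QuantumLattice.cloverPseudoscalar_def,
    hC 0 1 (Or.inl ⟨rfl, by decide⟩), hC 0 2 (Or.inl ⟨rfl, by decide⟩), hC 0 3 (Or.inl ⟨rfl, by decide⟩),
    hC 2 3 (Or.inr ⟨by decide, by decide⟩), hC 1 3 (Or.inr ⟨by decide, by decide⟩), hC 1 2 (Or.inr ⟨by decide, by decide⟩)]

end Support

/-! ## §2 The flowed slab-charge correlator across the LINK plane is non-positive for `β ≥ 0` — odd separations -/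

section Positivity

variable {L n : ℕ} [NeZero L]

/-- **THE MEASURED (RK3-FLOWED) SLAB CHARGE ACROSS THE LINK PLANE IS NON-POSITIVELY CORRELATED WITH ITS MIRROR SLICE `1 − t`**
(`β ≥ 0`, `L` even, every `ε'`, `m`, `3m + 2 ≤ t.val`, `t.val + 3m + 2 ≤ L/2`; time separation `2 t.val − 1`, the ODD ones):
`∫ (Σ_{x₀ = t} P_x ∘ RK3^m) · (Σ_{x₀ = t} P_{θx} ∘ RK3^m) dμ_β ≤ 0`. -/
theorem integral_rk3SlabCharge_mul_linkMirror_nonpos (hL : Even L) {β : ℝ} (hβ : 0 ≤ β) (ε' : ℝ) (m : ℕ) (t : ZMod L)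
    (hlo : 3 * m + 2 ≤ t.val) (hhi : t.val + 3 * m + 2 ≤ L / 2) :
    ∫ U, (∑ x ∈ Finset.univ.filter (fun x : Site 4 L => x 0 = t),
          cloverPseudoscalar (fundamentalRep (Fin n)) x ((wilsonFlowRK3 ε')^[m] U)) *
        (∑ x ∈ Finset.univ.filter (fun x : Site 4 L => x 0 = t),
          cloverPseudoscalar (fundamentalRep (Fin n)) (Site.timeReflect x) ((wilsonFlowRK3 ε')^[m] U))
      ∂(wilsonMeasure (d := 4) (L := L) (fundamentalRep (Fin n)) β) ≤ 0 := by
  set Φ : GaugeConfig 4 L (Matrix.specialUnitaryGroup (Fin n) ℂ) → GaugeConfig 4 L (Matrix.specialUnitaryGroup (Fin n) ℂ) :=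
    (wilsonFlowRK3 ε')^[m] with hΦ
  have hΦm : Measurable Φ := (continuous_iterate_wilsonFlowRK3 ε' m).measurable
  have hρc := continuous_fundamentalRep (Fin n)
  have hρu : ∀ g : Matrix.specialUnitaryGroup (Fin n) ℂ, fundamentalRep (Fin n) g ∈ Matrix.unitaryGroup (Fin n) ℂ :=
    fundamentalRep_mem_unitaryGroup
  -- measurability and boundedness of the flowed slab charge
  have hFm : Measurable fun U : GaugeConfig 4 L (Matrix.specialUnitaryGroup (Fin n) ℂ) =>
      ∑ x ∈ Finset.univ.filter (fun x : Site 4 L => x 0 = t), cloverPseudoscalar (fundamentalRep (Fin n)) x (Φ U) :=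
    Finset.measurable_sum _ fun x _ => ((continuous_cloverPseudoscalar _ hρc x).measurable).comp hΦm
  obtain ⟨C, hC⟩ : ∃ C : ℝ, ∀ (x : Site 4 L) (W : GaugeConfig 4 L (Matrix.specialUnitaryGroup (Fin n) ℂ)),
      |cloverPseudoscalar (fundamentalRep (Fin n)) x W| ≤ C := by
    choose c hc using fun x : Site 4 L => exists_abs_cloverPseudoscalar_le (fundamentalRep (Fin n)) hρc (R := ZMod L) x
    exact ⟨Finset.univ.sup' ⟨0, Finset.mem_univ _⟩ c, fun x W => (hc x W).trans (Finset.le_sup' c (Finset.mem_univ x))⟩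
  have hFb : ∃ K : ℝ, ∀ U : GaugeConfig 4 L (Matrix.specialUnitaryGroup (Fin n) ℂ),
      |∑ x ∈ Finset.univ.filter (fun x : Site 4 L => x 0 = t), cloverPseudoscalar (fundamentalRep (Fin n)) x (Φ U)| ≤ K :=
    ⟨∑ x ∈ Finset.univ.filter (fun x : Site 4 L => x 0 = t), C, fun U =>
      (Finset.abs_sum_le_sum_abs _ _).trans (Finset.sum_le_sum fun x _ => hC x (Φ U))⟩
  have hdep := dependsOn_rk3SlabCharge_posEdges (n := n) ε' m t hlo hhi
  have key := FariaDaVeigaOCarroll2022.integral_mul_timeReflect_nonneg (fundamentalRep (Fin n)) hL hρc hβ hFm hFb hdep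
  -- oddness of the density and covariance of the flow under the link reflection
  have hodd : ∀ (W : GaugeConfig 4 L (Matrix.specialUnitaryGroup (Fin n) ℂ)) (x : Site 4 L),
      cloverPseudoscalar (fundamentalRep (Fin n)) x W.timeReflect =
        -cloverPseudoscalar (fundamentalRep (Fin n)) (Site.timeReflect x) W := fun W x =>
    cloverPseudoscalar_reflect (fundamentalRep (Fin n)) hρu (Site.timeReflect (d := 4) (L := L))
      (fun z => by funext k; by_cases hk : k = 0 <;> [(subst hk; simp [Site.timeReflect]); simp [Site.timeReflect, hk]])
      (fun z i hi => by funext k; by_cases hk : k = 0 <;> [(subst hk; simp [Site.timeReflect, hi.symm]); simp [Site.timeReflect, hk]])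
      W W.timeReflect (fun z => by unfold GaugeConfig.timeReflect; rw [if_pos rfl]; rfl)
      (fun z i hi => by unfold GaugeConfig.timeReflect; rw [if_neg hi]) x
  have hrefl : ∀ U : GaugeConfig 4 L (Matrix.specialUnitaryGroup (Fin n) ℂ),
      (∑ x ∈ Finset.univ.filter (fun x : Site 4 L => x 0 = t), cloverPseudoscalar (fundamentalRep (Fin n)) x (Φ U.timeReflect)) =
        -∑ x ∈ Finset.univ.filter (fun x : Site 4 L => x 0 = t),
          cloverPseudoscalar (fundamentalRep (Fin n)) (Site.timeReflect x) (Φ U) := by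
    intro U
    rw [hΦ, iterate_wilsonFlowRK3_timeReflect, ← Finset.sum_neg_distrib]
    exact Finset.sum_congr rfl fun x _ => hodd _ x
  simp only [hrefl, mul_neg, integral_neg] at key
  simpa [hΦ] using key

end Positivity

end Summit.Ventures.LatticeQCDFlow.Exactness
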